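import Mathlib
import Literature.NumberTheory.EllipticCurves.HeckeOperatorsProofs
import Literature.NumberTheory.EllipticCurves.CuspFormLFunction
import Summits.ABC.ABC.Theses.RibetTakahashiSplit

/-!
# Sketch — crux-idea `arakelov-jensen-zero-heights` for crux stmt-ABC-1561
(`Summit.ABC.ABC.Theses.RibetTakahashiSplit.ManyPrimeValuationProduct`)

First checkable statements of the line (planner sketch; nothing here is a route item).

* `JensenLogIntegral` (L0, analytic core, provable from Mathlib's Jensen/concavity of `log`):
  mean of `log u` ≤ `log` of mean of `u` on a probability space.
* `log_valuationProduct_le_of_identities` (L1, PROVED bookkeeping): the Arakelov identity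
  `h(div f) + V − ω̄² = (g−1)·(mean of log ‖f‖²_pt)`, Jensen, and the Ribet–Takahashi–Pasten identity
  `log T_D ≤ log vol − log ‖f_D^int‖² + δ` give `log T_D ≤ (ω̄² − h − V)/(g−1) + δ ≤ ω̄²/(g−1) + δ`.
* `ReverseJensenDefectX0 Y` (L2, the statable D = 1 proxy of the eigenform-specific input J3):
  for prime level `N` and the newform `f` of an elliptic curve of conductor `N`, the regularised
  Jensen defect `log(mean ‖f‖²_pt) − mean(log ‖f‖²_pt)` over the truncated curve `X₀(N)_{≤Y}`
  (written as an integral over the truncated standard fundamental domain of the coset sum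
  `φ(τ) + Σ_{j<N} φ((τ+j)/N)`, valid for prime `N` by `W_N`-invariance of `‖f‖²_pt`) is
  `≤ ε log N + C_ε`. Tested numerically by kit job (see card).
The genuine first rung (★) on the Shimura curve `X₀^D(M)` awaits the wanted definition
`ShimuraCurveIntegralForms` plus Arakelov data (card items D1/D2).
-/

noncomputable section

open MeasureTheory
open scoped MatrixGroups ModularForm

namespace Summit.ABC.ABC.Cruxes.ManyPrimeValuationProduct.ArakelovJensen

open Literature.NumberTheory.EllipticCurves.ModularForms (tpB IsNewformOf)
open CongruenceSubgroup

/-- **L0 (analytic core).** Jensen's inequality for `log` on a probability space: for a positive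
integrable `u` with `log ∘ u` integrable, `∫ log u dμ ≤ log ∫ u dμ`. -/
def JensenLogIntegral : Prop :=
  ∀ (α : Type) [MeasurableSpace α] (μ : Measure α) [IsProbabilityMeasure μ] (u : α → ℝ),
    (∀ x, 0 < u x) → Integrable u μ → Integrable (fun x => Real.log (u x)) μ →
    ∫ x, Real.log (u x) ∂μ ≤ Real.log (∫ x, u x ∂μ)

/-- **L1 (bookkeeping, proved).** `g` = genus of the Shimura curve, `ω2` = arithmetic
self-intersection `ω̄²` of its regular model, `h ≥ 0` = `ω̄`-height of the horizontal zero divisor of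
the integral Jacquet–Langlands eigenform `f_D^int`, `V ≥ 0` = its vertical part, `m` = mean of
`log ‖f_D^int‖²_pt` for the normalised curvature measure, `lognorm = log ‖f_D^int‖²_{L²}`,
`logvol = log vol`, `logT = log ∏_{p ∣ D} ord_p Δ_min`, `δ` = the `o(log N)` slack of the
Ribet–Takahashi–Pasten identity (incl. `log (f,f) − log vol`). -/
theorem log_valuationProduct_le_of_identities
    (g ω2 h V m logT logvol lognorm δ : ℝ) (hg : 1 < g) (hh : 0 ≤ h) (hV : 0 ≤ V)
    (hId : h + V - ω2 = (g - 1) * m)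
    (hJ : m ≤ lognorm - logvol)
    (hP : logT ≤ logvol - lognorm + δ) :
    logT ≤ (ω2 - h - V) / (g - 1) + δ ∧ logT ≤ ω2 / (g - 1) + δ := by
  have hg' : 0 < g - 1 := by linarith
  have key : (ω2 - h - V) / (g - 1) = -m := by
    rw [div_eq_iff hg'.ne']
    linarith
  have h1 : logT ≤ (ω2 - h - V) / (g - 1) + δ := by rw [key]; linarith
  refine ⟨h1, h1.trans ?_⟩
  have : (ω2 - h - V) / (g - 1) ≤ ω2 / (g - 1) :=
    div_le_div_of_nonneg_right (by linarith) hg'.le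
  linarith

/-- Pointwise log-Petersson norm `log (|f(τ)|² (im τ)²)` of a weight-2 cusp form. -/
def logPet {Γ : Subgroup (GL (Fin 2) ℝ)} (f : CuspForm Γ 2) (τ : UpperHalfPlane) : ℝ :=
  Real.log (‖f τ‖ ^ 2 * τ.im ^ 2)

/-- Coset sum realising `∫_{X₀(N)} φ dμ = ∫_{fd} (φ(τ) + Σ_{j<N} φ((τ+j)/N)) dμ(τ)` for PRIME `N`
and `W_N`-invariant, `Γ₀(N)`-invariant `φ` (coset representatives `1, S Tʲ`, then `W_N`). -/
def cosetSum (N : ℕ) [NeZero N] (φ : UpperHalfPlane → ℝ) (τ : UpperHalfPlane) : ℝ :=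
  φ τ + ∑ j ∈ Finset.range N, φ (tpB N (j : ℤ) • τ)

/-- The standard fundamental domain truncated at height `Y`. -/
def fdTrunc (Y : ℝ) : Set UpperHalfPlane := ModularGroup.fd ∩ {τ | τ.im ≤ Y}

/-- **L2 (D = 1 proxy of the eigenform-specific input J3; conjecture, numerically tested).**
Regularised reverse-Jensen defect of newforms of prime level: `log(mean) − mean(log)` of the
pointwise Petersson norm over `X₀(N)_{im ≤ Y}` is `≤ ε log N + C`. -/
def ReverseJensenDefectX0 (Y : ℝ) : Prop :=
  ∀ ε : ℝ, 0 < ε → ∃ C : ℝ, ∀ (N : ℕ) [NeZero N], N.Prime →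
    ∀ (W : WeierstrassCurve ℚ) (f : CuspForm (Gamma0 N) 2), IsNewformOf W f →
      Real.log ((∫ τ in fdTrunc Y, cosetSum N (fun σ => Real.exp (logPet f σ)) τ) /
          (((N : ℝ) + 1) * (volume (fdTrunc Y)).toReal))
        - (∫ τ in fdTrunc Y, cosetSum N (logPet f) τ) /
          (((N : ℝ) + 1) * (volume (fdTrunc Y)).toReal)
        ≤ ε * Real.log N + C

/-- The crux this sketch serves (by name, for the audit). -/
example : Prop := Summit.ABC.ABC.Theses.RibetTakahashiSplit.ManyPrimeValuationProduct

end Summit.ABC.ABC.Cruxes.ManyPrimeValuationProduct.ArakelovJensen
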